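import Summits.Ventures.DiscreteObjects.STD.OrderFiveReduction

/-!
# STD₂[12;6]: an automorphism of order 3 fixing a point class and a block class is fixed-point-free (kernel; order-3 landscape)
Framing: lottery ticket; floor = certified bounds/negative ranges.

Cell pub-namedobj (target M), STD₂[12;6] automorphism census (designs g6, FAMILY-P5.md §8: what is left of Aut after P5 are
class-moving elements of order 2 and 3). In the incidence-array vocabulary of `OrderFiveReduction` (`IncArray`, `IsSTD`,
`ArrayAut`, `fixedCard`) we prove `order_three_fixed_point_free`: for an STD₂[12;6] and an array automorphism `τ` with `σ³ = 1`,
`ρ³ = 1`, `(β j)³ = 1` on every fixed block class, not the identity on points, fixing AT LEAST ONE point class and at least one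
block class, EVERY fixed class carries NO fixed label — `τ` has no fixed point and no fixed block. Hence the label type `3·1³`
('three fixed labels') never occurs, and with fixed classes on both sides only the type `3²` remains (FAMILY-P5 §8 cells
(c,c), c = 1,2,3); the class-fixing case c = 0 is designs g5's ZC-3.
Steps: fixed labels on a fixed class number 0, 3 or 6 and agree across all fixed classes (conjugacy, `fixedCard_alpha_eq_beta`);
6 is the identity type, impossible as for order 5 (`no_identity_type_three`: an orbit of a moved point lies on two fixed blocks,
3 > 2 common points; if no class moves, `τ = id`); 3 is impossible by a PIGEONHOLE: a fixed point lies on one block `B` of a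
moved block class and then on `τB`, `τ²B`, so two fixed points never share such a block and the fixed labels of three fixed point
classes inject disjointly into the 6 labels of that block class, 9 ≤ 6 (`fixed_labels_disjoint`); dually when only point classes
move; and when nothing moves a fixed point forces every other class to be fixed labelwise (`all_fixed_of_classFixing`), 6 ≠ 3.
The type-3² cells themselves are NOT decided here (searches for a successor, FAMILY-P5 §8).
-/

namespace Summit.Ventures.DiscreteObjects.STD

open Finset Equiv Summit.Ventures.DiscreteObjects.PP12

section PermFacts

variable {n : ℕ}

/-- A permutation of `Fin 12` with `σ³ = 1` fixes 0, 3, 6, 9 or 12 points. -/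
theorem fixedCard_twelve_of_pow_three {σ : Perm (Fin 12)} (hσ : σ ^ 3 = 1) :
    fixedCard σ = 0 ∨ fixedCard σ = 3 ∨ fixedCard σ = 6 ∨ fixedCard σ = 9 ∨ fixedCard σ = 12 := by
  haveI : Fact (Nat.Prime 3) := ⟨by norm_num⟩
  have h1 := fixedCard_modEq hσ
  have h2 := fixedCard_le σ
  simp only [Fintype.card_fin] at h1
  unfold Nat.ModEq at h1
  omega

/-- A permutation of `Fin 6` with `α³ = 1` fixes 0, 3 or 6 points. -/
theorem fixedCard_six_of_pow_three {α : Perm (Fin 6)} (hα : α ^ 3 = 1) :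
    fixedCard α = 0 ∨ fixedCard α = 3 ∨ fixedCard α = 6 := by
  haveI : Fact (Nat.Prime 3) := ⟨by norm_num⟩
  have h1 := fixedCard_modEq hα
  have h2 := fixedCard_le α
  simp only [Fintype.card_fin] at h1
  unfold Nat.ModEq at h1
  omega

/-- If `σ³ = 1` and `σᵈ y = y` for `0 < d < 3` then `σ y = y`. -/
theorem fixed_of_pow_fixed_three {σ : Perm (Fin n)} (hσ : σ ^ 3 = 1) {d : ℕ} (hd0 : 0 < d) (hd3 : d < 3)
    {y : Fin n} (h : (σ ^ d) y = y) : σ y = y := by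
  have h3 : (σ ^ 3) y = y := by rw [hσ]; rfl
  interval_cases d
  · simpa using h
  · have h4 : (σ ^ 4) y = y := by
      rw [show (4 : ℕ) = 2 + 2 from rfl, pow_add, Perm.mul_apply, h, h]
    have : (σ ^ 4) y = σ y := by
      rw [show (4 : ℕ) = 1 + 3 from rfl, pow_add, Perm.mul_apply, h3, pow_one]
    rw [this] at h4; exact h4

/-- If `σ³ = 1` and `σ i ≠ i`, the classes `σᵐ i`, `m < 3`, are pairwise distinct. -/
theorem pow_apply_injective_three {σ : Perm (Fin n)} (hσ : σ ^ 3 = 1) {i : Fin n} (hi : σ i ≠ i) :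
    Function.Injective fun m : Fin 3 => (σ ^ (m : ℕ)) i := by
  intro m m' hmm
  simp only at hmm
  by_contra hne
  rcases lt_or_gt_of_ne (fun h : (m : ℕ) = m' => hne (Fin.ext h)) with hlt | hlt
  · have hd : (σ ^ ((m' : ℕ) - m)) ((σ ^ (m : ℕ)) i) = (σ ^ (m : ℕ)) i := by
      rw [← Perm.mul_apply, ← pow_add, Nat.sub_add_cancel hlt.le, ← hmm]
    have hy := fixed_of_pow_fixed_three hσ (Nat.sub_pos_of_lt hlt) (by omega) hd
    apply hi
    have : (σ ^ (m : ℕ)) (σ i) = (σ ^ (m : ℕ)) i := by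
      rw [← Perm.mul_apply, ← pow_succ, pow_succ', Perm.mul_apply, hy]
    exact (σ ^ (m : ℕ)).injective this
  · have hd : (σ ^ ((m : ℕ) - m')) ((σ ^ (m' : ℕ)) i) = (σ ^ (m' : ℕ)) i := by
      rw [← Perm.mul_apply, ← pow_add, Nat.sub_add_cancel hlt.le, hmm]
    have hy := fixed_of_pow_fixed_three hσ (Nat.sub_pos_of_lt hlt) (by omega) hd
    apply hi
    have : (σ ^ (m' : ℕ)) (σ i) = (σ ^ (m' : ℕ)) i := by
      rw [← Perm.mul_apply, ← pow_succ, pow_succ', Perm.mul_apply, hy]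
    exact (σ ^ (m' : ℕ)).injective this

/-- Three distinct fixed points from `3 ≤ fixedCard`. -/
theorem three_fixed_of_le {τ : Perm (Fin n)} (h : 3 ≤ fixedCard τ) :
    ∃ x y z, x ≠ y ∧ x ≠ z ∧ y ≠ z ∧ τ x = x ∧ τ y = y ∧ τ z = z := by
  unfold fixedCard at h
  obtain ⟨x, y, z, hx, hy, hz, hxy, hxz, hyz⟩ := two_lt_card_iff.mp h
  simp only [mem_filter, mem_univ, true_and] at hx hy hz
  exact ⟨x, y, z, hxy, hxz, hyz, hx, hy, hz⟩

/-- Some fixed point from `0 < fixedCard`. -/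
theorem exists_fixed_of_pos {τ : Perm (Fin n)} (h : 0 < fixedCard τ) : ∃ x, τ x = x := by
  unfold fixedCard at h
  obtain ⟨x, hx⟩ := card_pos.mp h
  exact ⟨x, by simpa using (mem_filter.mp hx).2⟩

end PermFacts

section OrderThree

variable (π : IncArray 12 6) (τ : ArrayAut π)

/-- Identity type is impossible for order 3 (cf. `no_identity_type` for order 5): two fixed block classes with trivial label
maps and a moved point class give two blocks of different classes through a whole 3-orbit. -/
theorem no_identity_type_three (hπ : IsSTD 2 π) (hσ : τ.σ ^ 3 = 1) {j₁ j₂ : Fin 12} (hj : j₁ ≠ j₂) (hj₁ : τ.ρ j₁ = j₁)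
    (hj₂ : τ.ρ j₂ = j₂) (hb₁ : τ.β j₁ = 1) (hb₂ : τ.β j₂ = 1) {i : Fin 12} (hi : τ.σ i ≠ i) : False := by
  let aSeq : ℕ → Fin 6 := fun m => Nat.rec (0 : Fin 6) (fun m a => τ.α ((τ.σ ^ m) i) a) m
  have aSeq_succ : ∀ m, aSeq (m + 1) = τ.α ((τ.σ ^ m) i) (aSeq m) := fun m => rfl
  have aSeq_zero : aSeq 0 = 0 := rfl
  have key : ∀ (j : Fin 12), τ.ρ j = j → τ.β j = 1 → ∀ m : ℕ, π ((τ.σ ^ m) i) j (aSeq m) = π i j 0 := by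
    intro j hjf hbj m
    induction m with
    | zero => simp [aSeq_zero]
    | succ m ih =>
      rw [aSeq_succ, pow_succ', Perm.mul_apply]
      have h := τ.map_inc ((τ.σ ^ m) i) j (aSeq m)
      rw [hjf, hbj, ih] at h
      simpa using h
  have hcount := hπ.2 j₁ j₂ hj (π i j₁ 0) (π i j₂ 0)
  have hsub : (univ.image fun m : Fin 3 => (τ.σ ^ (m : ℕ)) i) ⊆
      univ.filter (fun i' => (π i' j₁).symm (π i j₁ 0) = (π i' j₂).symm (π i j₂ 0)) := by
    intro i' hi'
    obtain ⟨m, -, rfl⟩ := mem_image.mp hi'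
    simp only [mem_filter, mem_univ, true_and]
    rw [← key j₁ hj₁ hb₁ m, ← key j₂ hj₂ hb₂ m, Equiv.symm_apply_apply, Equiv.symm_apply_apply]
  have hcard : (univ.image fun m : Fin 3 => (τ.σ ^ (m : ℕ)) i).card = 3 := by
    rw [card_image_of_injective _ (pow_apply_injective_three hσ hi)]; simp
  have := card_le_card hsub
  rw [hcard, hcount] at this
  omega

/-- A fixed point `(i,a)` lies, in every block class of the orbit of `j`, on the same label as in `j` transported by the `β`'s:
concretely `π i (ρᵐ j) a` is obtained from `π i j a` by the label maps, and two fixed points sharing the block in class `j` share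
the blocks in the classes `ρ j`, `ρ² j` as well. Here: the common-class set of two fixed points is `ρ`-stable. -/
theorem common_class_map {i i' : Fin 12} {a b : Fin 6} (hi : τ.σ i = i) (ha : τ.α i a = a) (hi' : τ.σ i' = i')
    (hb : τ.α i' b = b) {j : Fin 12} (h : π i j a = π i' j b) : π i (τ.ρ j) a = π i' (τ.ρ j) b := by
  have h1 := τ.map_inc i j a
  have h2 := τ.map_inc i' j b
  rw [hi, ha] at h1
  rw [hi', hb] at h2
  rw [h1, h2, h]

/-- PIGEONHOLE core: if the block class `j₀` is moved by `ρ`, two distinct fixed points of different fixed classes never lie on a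
common block of class `j₀` (they would share the three blocks of classes `j₀, ρ j₀, ρ² j₀`). -/
theorem fixed_points_separate (hπ : IsSTD 2 π) (hρ : τ.ρ ^ 3 = 1) {j₀ : Fin 12} (hj₀ : τ.ρ j₀ ≠ j₀)
    {i i' : Fin 12} (hii' : i ≠ i') {a b : Fin 6} (hi : τ.σ i = i) (ha : τ.α i a = a) (hi' : τ.σ i' = i')
    (hb : τ.α i' b = b) : π i j₀ a ≠ π i' j₀ b := by
  intro h
  have key : ∀ m : ℕ, π i ((τ.ρ ^ m) j₀) a = π i' ((τ.ρ ^ m) j₀) b := by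
    intro m
    induction m with
    | zero => simpa using h
    | succ m ih =>
      rw [pow_succ', Perm.mul_apply]
      exact common_class_map π τ hi ha hi' hb ih
  have hcount := hπ.1 i i' hii' a b
  have hsub : (univ.image fun m : Fin 3 => (τ.ρ ^ (m : ℕ)) j₀) ⊆ univ.filter (fun j => π i j a = π i' j b) := by
    intro j hj
    obtain ⟨m, -, rfl⟩ := mem_image.mp hj
    simp only [mem_filter, mem_univ, true_and]
    exact key m
  have hcard : (univ.image fun m : Fin 3 => (τ.ρ ^ (m : ℕ)) j₀).card = 3 := by
    rw [card_image_of_injective _ (pow_apply_injective_three hρ hj₀)]; simp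
  have := card_le_card hsub
  rw [hcard, hcount] at this
  omega

/-- the fixed labels of class `i`, pushed to the labels of block class `j₀` -/
def fixedImage (i j₀ : Fin 12) : Finset (Fin 6) := (univ.filter fun a => τ.α i a = a).image fun a => π i j₀ a

/-- `fixedImage` has as many elements as the class has fixed labels. -/
theorem card_fixedImage (i j₀ : Fin 12) : (fixedImage π τ i j₀).card = fixedCard (τ.α i) := by
  unfold fixedImage fixedCard
  exact card_image_of_injective _ (π i j₀).injective

/-- Images of the fixed labels of two distinct fixed classes are disjoint in a moved block class. -/
theorem fixedImage_disjoint (hπ : IsSTD 2 π) (hρ : τ.ρ ^ 3 = 1) {j₀ : Fin 12} (hj₀ : τ.ρ j₀ ≠ j₀)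
    {i i' : Fin 12} (hii' : i ≠ i') (hi : τ.σ i = i) (hi' : τ.σ i' = i') :
    Disjoint (fixedImage π τ i j₀) (fixedImage π τ i' j₀) := by
  rw [disjoint_left]
  intro c hc hc'
  unfold fixedImage at hc hc'
  obtain ⟨a, ha, rfl⟩ := mem_image.mp hc
  obtain ⟨b, hb, hab⟩ := mem_image.mp hc'
  simp only [mem_filter, mem_univ, true_and] at ha hb
  exact fixed_points_separate π τ hπ hρ hj₀ hii' hi ha hi' hb hab.symm

/-- **Pigeonhole.** With a moved block class, three distinct fixed point classes cannot each carry 3 fixed labels. -/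
theorem not_three_fixed_labels (hπ : IsSTD 2 π) (hρ : τ.ρ ^ 3 = 1) {j₀ : Fin 12} (hj₀ : τ.ρ j₀ ≠ j₀)
    {i₁ i₂ i₃ : Fin 12} (h12 : i₁ ≠ i₂) (h13 : i₁ ≠ i₃) (h23 : i₂ ≠ i₃) (hi₁ : τ.σ i₁ = i₁) (hi₂ : τ.σ i₂ = i₂)
    (hi₃ : τ.σ i₃ = i₃) (n₁ : fixedCard (τ.α i₁) = 3) (n₂ : fixedCard (τ.α i₂) = 3) (n₃ : fixedCard (τ.α i₃) = 3) :
    False := by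
  have d12 := fixedImage_disjoint π τ hπ hρ hj₀ h12 hi₁ hi₂
  have d13 := fixedImage_disjoint π τ hπ hρ hj₀ h13 hi₁ hi₃
  have d23 := fixedImage_disjoint π τ hπ hρ hj₀ h23 hi₂ hi₃
  have hU : ((fixedImage π τ i₁ j₀ ∪ fixedImage π τ i₂ j₀) ∪ fixedImage π τ i₃ j₀).card = 9 := by
    rw [card_union_of_disjoint (disjoint_union_left.mpr ⟨d13, d23⟩), card_union_of_disjoint d12,
      card_fixedImage, card_fixedImage, card_fixedImage, n₁, n₂, n₃]
  have hle : ((fixedImage π τ i₁ j₀ ∪ fixedImage π τ i₂ j₀) ∪ fixedImage π τ i₃ j₀).card ≤ 6 :=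
    (card_le_univ _).trans (by simp)
  omega

/-- Class-fixing with a fixed point: if `σ = 1`, `ρ = 1` and some point `(i,a)` is fixed, every label of every other class is
fixed (the other common point of two fixed blocks through `(i,a)` is fixed) — designs g5's 'a class-fixing automorphism fixing
a point is trivial', in the form needed here. -/
theorem all_fixed_of_classFixing (hπ : IsSTD 2 π) (hσ1 : ∀ i, τ.σ i = i) (hρ1 : ∀ j, τ.ρ j = j) {i : Fin 12} {a : Fin 6}
    (ha : τ.α i a = a) {i' : Fin 12} (hii' : i ≠ i') (b : Fin 6) : τ.α i' b = b := by
  -- a common block class of (i,a) and (i',b)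
  have hcount := hπ.1 i i' hii' a b
  obtain ⟨j, hj⟩ : ∃ j, j ∈ univ.filter (fun j => π i j a = π i' j b) := by
    apply Finset.Nonempty.exists_mem
    rw [← card_pos, hcount]; norm_num
  simp only [mem_filter, mem_univ, true_and] at hj
  have h1 := τ.map_inc i j a
  have h2 := τ.map_inc i' j b
  rw [hσ1, hρ1, ha, hj] at h1
  rw [hσ1, hρ1, ← h1] at h2
  exact (π i' j).injective h2

/-- the dual array: the same structure with points and blocks exchanged (`(π i j).symm` read as 'the point of class `i` on block
`(j,c)`') -/
def dualArray : IncArray 12 6 := fun j i => (π i j).symm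

/-- the dual automorphism -/
def dualAut : ArrayAut (dualArray π) where
  σ := τ.ρ
  α := τ.β
  ρ := τ.σ
  β := τ.α
  map_inc := by
    intro j i c
    unfold dualArray
    rw [Equiv.symm_apply_eq]
    have h := τ.map_inc i j ((π i j).symm c)
    rw [Equiv.apply_symm_apply] at h
    exact h.symm

/-- The dual of an STD₂ array is an STD₂ array (the two halves of `IsSTD` exchange). -/
theorem isSTD_dual (hπ : IsSTD 2 π) : IsSTD 2 (dualArray π) := by
  refine ⟨fun j j' hjj' c d => ?_, fun i i' hii' a b => ?_⟩
  · unfold dualArray; exact hπ.2 j j' hjj' c d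
  · unfold dualArray
    simp only [Equiv.symm_symm]
    exact hπ.1 i i' hii' a b

/-- **Order-3 landscape lemma.** An automorphism of order 3 of an STD₂[12;6] (array form; `σ³ = ρ³ = 1`, `(β j)³ = 1` on fixed
block classes — the same for the `α i` follows by conjugacy and is not assumed — not the identity on points) that fixes at least one point class and at least
one block class has NO fixed label on any fixed class: it acts fixed-point-freely on points and on blocks. -/
theorem order_three_fixed_point_free (hπ : IsSTD 2 π) (hσ : τ.σ ^ 3 = 1) (hρ : τ.ρ ^ 3 = 1)
    (hβ : ∀ j, τ.ρ j = j → τ.β j ^ 3 = 1)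
    (hne : ¬ (τ.σ = 1 ∧ ∀ i, τ.α i = 1)) (hfix : ∃ i, τ.σ i = i) (hfixB : ∃ j, τ.ρ j = j) :
    (∀ i, τ.σ i = i → fixedCard (τ.α i) = 0) ∧ (∀ j, τ.ρ j = j → fixedCard (τ.β j) = 0) := by
  obtain ⟨i₀, hi₀⟩ := hfix
  obtain ⟨j₀, hj₀⟩ := hfixB
  have hAll_α : ∀ i, τ.σ i = i → fixedCard (τ.α i) = fixedCard (τ.β j₀) := fun i h => fixedCard_alpha_eq_beta π τ h hj₀
  have hAll_β : ∀ j, τ.ρ j = j → fixedCard (τ.β j) = fixedCard (τ.β j₀) := fun j h =>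
    (fixedCard_alpha_eq_beta π τ hi₀ h).symm.trans (fixedCard_alpha_eq_beta π τ hi₀ hj₀)
  have hP := fixedCard_twelve_of_pow_three hσ
  have hB := fixedCard_twelve_of_pow_three hρ
  have hP0 : fixedCard τ.σ ≠ 0 := by
    intro h0; unfold fixedCard at h0
    have : i₀ ∈ univ.filter (fun i => τ.σ i = i) := by simp [hi₀]
    rw [card_eq_zero.mp h0] at this; simp at this
  have hB0 : fixedCard τ.ρ ≠ 0 := by
    intro h0; unfold fixedCard at h0
    have : j₀ ∈ univ.filter (fun j => τ.ρ j = j) := by simp [hj₀]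
    rw [card_eq_zero.mp h0] at this; simp at this
  rcases fixedCard_six_of_pow_three (hβ j₀ hj₀) with h0 | h3 | h6
  · exact ⟨fun i h => (hAll_α i h).trans h0, fun j h => (hAll_β j h).trans h0⟩
  · -- three fixed labels on every fixed class: impossible
    exfalso
    have hα3 : ∀ i, τ.σ i = i → fixedCard (τ.α i) = 3 := fun i h => (hAll_α i h).trans h3
    have hβ3 : ∀ j, τ.ρ j = j → fixedCard (τ.β j) = 3 := fun j h => (hAll_β j h).trans h3
    by_cases hmovB : ∃ j, τ.ρ j ≠ j
    · obtain ⟨j₁, hj₁⟩ := hmovB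
      obtain ⟨i₁, i₂, i₃, h12, h13, h23, hi₁, hi₂, hi₃⟩ := three_fixed_of_le (τ := τ.σ) (by omega)
      exact not_three_fixed_labels π τ hπ hρ hj₁ h12 h13 h23 hi₁ hi₂ hi₃ (hα3 _ hi₁) (hα3 _ hi₂) (hα3 _ hi₃)
    · push Not at hmovB
      by_cases hmovP : ∃ i, τ.σ i ≠ i
      · -- dual pigeonhole: block classes all fixed, a point class moves
        obtain ⟨i₁, hi₁⟩ := hmovP
        obtain ⟨j₁, j₂, j₃, h12, h13, h23, -, -, -⟩ := three_fixed_of_le (τ := τ.ρ) (by omega)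
        exact not_three_fixed_labels (dualArray π) (dualAut π τ) (isSTD_dual π hπ) hσ (j₀ := i₁) hi₁ h12 h13 h23
          (hmovB j₁) (hmovB j₂) (hmovB j₃) (hβ3 _ (hmovB j₁)) (hβ3 _ (hmovB j₂)) (hβ3 _ (hmovB j₃))
      · push Not at hmovP
        -- class-fixing with fixed points: every other class is labelwise fixed, contradiction with 3 fixed labels
        obtain ⟨a, ha⟩ := exists_fixed_of_pos (τ := τ.α i₀) (by rw [hα3 i₀ hi₀]; norm_num)
        obtain ⟨i₁, hi₁ne⟩ : ∃ i₁ : Fin 12, i₁ ≠ i₀ := ⟨i₀ + 1, by simp⟩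
        have hall : ∀ b, τ.α i₁ b = b := fun b => all_fixed_of_classFixing π τ hπ hmovP hmovB ha hi₁ne.symm b
        have h6 : fixedCard (τ.α i₁) = 6 := by
          unfold fixedCard
          rw [filter_true_of_mem fun b _ => hall b]; simp
        have := hα3 i₁ (hmovP i₁)
        omega
  · -- six fixed labels: identity type
    exfalso
    obtain ⟨j₁, j₂, hj, hj₁, hj₂⟩ := two_fixed_of_le (τ := τ.ρ) (by omega)
    have hb₁ : τ.β j₁ = 1 := eq_one_of_fixedCard_eq _ ((hAll_β j₁ hj₁).trans h6)
    have hb₂ : τ.β j₂ = 1 := eq_one_of_fixedCard_eq _ ((hAll_β j₂ hj₂).trans h6)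
    by_cases hs : τ.σ = 1
    · apply hne
      refine ⟨hs, fun i => eq_one_of_fixedCard_eq _ ?_⟩
      exact (hAll_α i (by rw [hs]; rfl)).trans h6
    · have : ∃ i, τ.σ i ≠ i := by
        by_contra h
        push Not at h
        exact hs (Equiv.ext h)
      obtain ⟨i, hi⟩ := this
      exact no_identity_type_three π τ hπ hσ hj hj₁ hj₂ hb₁ hb₂ hi

end OrderThree

end Summit.Ventures.DiscreteObjects.STD
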